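import Mathlib
import Summits.QuantumFields.BalabanUV.Beta.UnitLatticeOmegaCells
import Summits.QuantumFields.BalabanUV.Beta.AnalyticWalkSum216RowRegroup

/-!
# `Summit.QuantumFields.BalabanUV.Beta.UnitLatticeOmegaDominates` — THE Ω-LAYER OUTPUT IN THE ROW OWNER'S REGROUPING
# CURRENCY: the undecorated ω-terms `walkTermΩ`, with dependence sets `decΩ` (their full decoration), are DOMINATED
# (`AnalyticWalkSum216RowRegroup.Dominates`) by the hand-off's majorant `decMajΩ (e^{κ₁P}) (κ₁P/r)` — thread currency
# AND cell currency — so the Ω-family regroups into the next layer's finite (T3)-slot (`Dominates.prod∕smul∕sum` +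
# `regroup_bound` BY NAME)

HONEST FRAMING (page 1 of everything in this cell).  Discharging `FlowStep.BetaPertH` would make Bałaban's ultraviolet
stability UNCONDITIONAL — a constructive-QFT result; NOT the continuum limit, NOT the Clay problem.  This module
discharges nothing of `BetaPertH`; [folklore] bookkeeping, kernel-checked (unit `b2b-balaban-beta-d4-p3`, road P3, gen 5;
skeleton v1.12 §7.9).  WHAT IT SETTLES (records): the row owner's `AnalyticWalkSum216RowRegroup` (p218827) NOT-CLAIMED item
«the domination for the co-owner's `decFamilyΩ` output (it holds by the proof of their `rowData_decFamilyΩ.hm` with the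
constant coefficient `e^{κ₁#decΩ}` in place of the monomial — not re-derived here)» — derived here BY NAME, once with the
gen-4 THREAD count (`UnitLatticeOmegaTube.card_decΩ_le`) and once with the gen-5 CELL count
(`UnitLatticeOmegaCells.card_decΩ_le_cells`).  Consequence for the chain G̃₀ → G₂ → G̃₂ → G̃₃(x): every factor of a
layer's recombined family (G-pieces: `dominates_pieces`; sandwich matrices: `dominates_const`; the Ω-family: THIS FILE) is
dominated, so the layer OUTPUT regroups by dependence set into the next layer's (T3)-slot INPUT with the same constant
(`regroup_bound`) — the cross-layer currency match the owner's interface item (I4) needs (the x-tilt pieces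
`R·G̃₂(ω)·Rᵀ` come from the G̃₂-layer's recombined family).  Nothing of Bałaban's operators is instantiated ((T3), NODE O.2
untouched); readiness width 0 unchanged; NOT summit progress.
HONEST DEPENDENCY: continuum YM on T⁴ ⇐ BetaPertH ∧ nine spine estimates (0/9 proved); BetaPertH ⇐
(D1) ∧ (D4) ∧ CAP+tail; G-an2-4 gates asym, D1 and NE2/3/4.

CITATION (locator only; nothing printed is used as a hypothesis).  [II] = T. Bałaban, *Renormalization group approach to
lattice gauge field theories. II. Cluster expansions*, Commun. Math. Phys. **116**, 1–22 (1988) [Balaban1988RG2Cluster],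
(1.6)–(1.8) p. 3 (terms localised in unions of cubes, monomials `Π s(□)`), (1.11) p. 5 (`e^{mκ₁}`).

CONTENTS (0 sorry).  §1 `norm_exp_coeff` (the constant coefficient as a complex scalar).  §2 **`dominates_walkTermΩ`** (thread
currency: the binders of `UnitLatticeOmegaTube.card_decΩ_le`) and **`dominates_walkTermΩ_cells`** (cell currency: the
binders of `UnitLatticeOmegaCells.card_decΩ_le_cells`): `Dominates κ₁ (decΩ …) (walkTermΩ …) (decMajΩ (e^{κ₁P}) (κ₁P/r) …)`
on the index type `WalkΩ B Ω`.  §3 non-vacuity (one-site data).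
NOT HERE: the regrouped Ω-pieces' row bound (= the owner's `regroup_bound` applied to §2 + `summable_decMajΩ` +
`row_majSum_decMajΩ_le`, all in the tree — composition left to the consumer), any instance.  NOT summit progress.
-/

open scoped BigOperators Matrix
open Finset Matrix Metric

namespace Summit.QuantumFields.BalabanUV.Beta.UnitLatticeOmegaDominates

open Summit.QuantumFields.BalabanUV.Beta.UnitLatticeWalkInversion
open Summit.QuantumFields.BalabanUV.Beta.UnitLatticeTubeCount (pathLen)
open Summit.QuantumFields.BalabanUV.Beta.UnitLatticeOmegaTerms
open Summit.QuantumFields.BalabanUV.Beta.UnitLatticeOmegaTube (crSum decΩ card_decΩ_le listLen)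
open Summit.QuantumFields.BalabanUV.Beta.UnitLatticeOmegaPaths
open Summit.QuantumFields.BalabanUV.Beta.UnitLatticeOmegaRowData
open Summit.QuantumFields.BalabanUV.Beta.UnitLatticeOmegaCells
open Summit.QuantumFields.BalabanUV.Beta.AnalyticWalkSum216RowRegroup (Dominates)
open Literature.MathematicalPhysics.QuantumFieldTheory.Balaban1983to89.B13PerturbativeStep (WeightHyp)

noncomputable section

variable {Y : Type*} [Fintype Y] [DecidableEq Y] {B Ω : Type*} [DecidableEq Ω] {Δ : Type*} [DecidableEq Δ]
  {κ : ℝ} {d : Y → Y → ℝ}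

/-! ## §1 The constant coefficient -/

omit [Fintype Y] [DecidableEq Y] [DecidableEq Ω] [DecidableEq Δ] in
/-- `‖(e^{t} : ℂ)‖ = e^{t}`. [folklore] -/
theorem norm_exp_coeff (t : ℝ) : ‖((Real.exp t : ℝ) : ℂ)‖ = Real.exp t := by
  rw [Complex.norm_real, Real.norm_eq_abs, abs_of_pos (Real.exp_pos t)]

/-! ## §2 Domination of the Ω-layer output -/

/-- **DOMINATION, THREAD CURRENCY.**  Under the geometric binders of `UnitLatticeOmegaTube.card_decΩ_le` (symmetric
pseudo-metric, cube neighbourhoods of diameter `≤ D`, threads covering the piece domains within `D_f`, step credits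
`cr ω ≥ 3·listLen(thr ω) + 2·D_f`, packing `P` at radius `R ≥ r + D, r + D_f`, `0 < r`) and `κ₁ ≥ 0`: for every ω-term `w`,
`e^{κ₁·#decΩ(w)}·‖walkTermΩ w (i,j)‖ ≤ e^{κ₁P}·walkMajΩ (κ₁P/r) w (i,j)` — i.e.
`Dominates κ₁ decΩ walkTermΩ (decMajΩ (e^{κ₁P}) (κ₁P/r))` in the row owner's letters. [cite: Balaban1988RG2Cluster, (1.11) p.5] -/
theorem dominates_walkTermΩ (hw : WeightHyp κ d) (hsymm : ∀ a b, d a b = d b a)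
    (K : Ω → Matrix Y Y ℂ) (Dω : Ω → Finset Y) (hK : ∀ ω k l, K ω k l ≠ 0 → k ∈ Dω ω) (near : B → Finset Ω)
    (h : B → Y → ℝ) (E : B → Finset Y) (L : B → Matrix Y Y ℂ) (hsupp : ∀ b y, y ∉ E b → h b y = 0)
    {κ₁ r D Df R : ℝ} (hκ₁ : 0 ≤ κ₁) (hr : 0 < r) (hRD : r + D ≤ R) (hRf : r + Df ≤ R) (cellOf : Y → Δ) {P : ℕ}
    (hpack : ∀ a : Y, ∃ S : Finset Δ, S.card ≤ P ∧ ∀ z, d a z ≤ R → cellOf z ∈ S)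
    (hdiam : ∀ b, ∀ z ∈ E b, ∀ z' ∈ E b, d z z' ≤ D) (thr : Ω → List Y)
    (hthr : ∀ ω, ∀ z ∈ Dω ω, ∃ p ∈ thr ω, d z p ≤ Df) (cr : Ω → ℝ) (hcr : ∀ ω, 3 * listLen d (thr ω) + 2 * Df ≤ cr ω) :
    Dominates κ₁ (fun w : WalkΩ B Ω => decΩ cellOf E Dω w.1 w.2.1 w.2.2)
      (fun w => walkTermΩ h K near L w.1 w.2.1 w.2.2) (decMajΩ (Real.exp (κ₁ * P)) (κ₁ * (P / r)) d cr h K near L) := by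
  intro w i j
  have hδ : 0 ≤ κ₁ * (P / r) := mul_nonneg hκ₁ (div_nonneg (Nat.cast_nonneg P) hr.le)
  have h1 := norm_coeff_mul_walkTermΩ_le h E hsupp K Dω hK near L hδ d hw.nonneg hw.tri cr (Real.exp_pos (κ₁ * P)).le
    w.1 w.2.1 w.2.2 (((Real.exp (κ₁ * (decΩ cellOf E Dω w.1 w.2.1 w.2.2).card) : ℝ) : ℂ)) (fun y hy => ?_) i j
  · rw [norm_exp_coeff] at h1
    simpa only [decMajΩ] using h1
  · rw [norm_exp_coeff, ← Real.exp_add]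
    refine Real.exp_le_exp.2 ?_
    have hcnt := card_decΩ_le d hw.tri hw.zero hw.nonneg hsymm hr hRD hRf cellOf hpack E hdiam Dω thr hthr cr hcr
      w.2.1 w.2.2 y hy
    have := mul_le_mul_of_nonneg_left hcnt hκ₁
    calc κ₁ * ((decΩ cellOf E Dω w.1 w.2.1 w.2.2).card : ℝ)
        ≤ κ₁ * (P * (1 + (pathLen d w.1 y + crSum cr w.1 w.2.2) / r)) := this
      _ = κ₁ * P + κ₁ * (P / r) * (pathLen d w.1 y + crSum cr w.1 w.2.2) := by ring

/-- **DOMINATION, CELL CURRENCY.**  Under the geometric binders of `UnitLatticeOmegaCells.card_decΩ_le_cells` (pseudo-metric,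
cube neighbourhoods of diameter `≤ D`, per-piece cell budgets with `cellOf z ∈ cellsOf ω` for `z ∈ D_ω`,
`r·#cellsOf ω ≤ P·cr ω`, packing `P` at radius `R ≥ r + D`, `0 < r`; NO symmetry, NO thread) and `κ₁ ≥ 0`:
`Dominates κ₁ decΩ walkTermΩ (decMajΩ (e^{κ₁P}) (κ₁P/r))`. [cite: Balaban1988RG2Cluster, (1.11) p.5] -/
theorem dominates_walkTermΩ_cells (hw : WeightHyp κ d)
    (K : Ω → Matrix Y Y ℂ) (Dω : Ω → Finset Y) (hK : ∀ ω k l, K ω k l ≠ 0 → k ∈ Dω ω) (near : B → Finset Ω)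
    (h : B → Y → ℝ) (E : B → Finset Y) (L : B → Matrix Y Y ℂ) (hsupp : ∀ b y, y ∉ E b → h b y = 0)
    {κ₁ r D R : ℝ} (hκ₁ : 0 ≤ κ₁) (hr : 0 < r) (hRD : r + D ≤ R) (cellOf : Y → Δ) {P : ℕ}
    (hpack : ∀ a : Y, ∃ S : Finset Δ, S.card ≤ P ∧ ∀ z, d a z ≤ R → cellOf z ∈ S)
    (hdiam : ∀ b, ∀ z ∈ E b, ∀ z' ∈ E b, d z z' ≤ D) (cellsOf : Ω → Finset Δ)
    (hcells : ∀ ω, ∀ z ∈ Dω ω, cellOf z ∈ cellsOf ω) (cr : Ω → ℝ)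
    (hcr : ∀ ω, r * ((cellsOf ω).card : ℝ) ≤ P * cr ω) :
    Dominates κ₁ (fun w : WalkΩ B Ω => decΩ cellOf E Dω w.1 w.2.1 w.2.2)
      (fun w => walkTermΩ h K near L w.1 w.2.1 w.2.2) (decMajΩ (Real.exp (κ₁ * P)) (κ₁ * (P / r)) d cr h K near L) := by
  intro w i j
  have hδ : 0 ≤ κ₁ * (P / r) := mul_nonneg hκ₁ (div_nonneg (Nat.cast_nonneg P) hr.le)
  have h1 := norm_coeff_mul_walkTermΩ_le h E hsupp K Dω hK near L hδ d hw.nonneg hw.tri cr (Real.exp_pos (κ₁ * P)).le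
    w.1 w.2.1 w.2.2 (((Real.exp (κ₁ * (decΩ cellOf E Dω w.1 w.2.1 w.2.2).card) : ℝ) : ℂ)) (fun y hy => ?_) i j
  · rw [norm_exp_coeff] at h1
    simpa only [decMajΩ] using h1
  · rw [norm_exp_coeff, ← Real.exp_add]
    refine Real.exp_le_exp.2 ?_
    have hcnt := card_decΩ_le_cells d hw.tri hw.zero hw.nonneg hr hRD cellOf hpack E hdiam Dω cellsOf hcells cr hcr
      w.2.1 w.2.2 y hy
    have := mul_le_mul_of_nonneg_left hcnt hκ₁
    calc κ₁ * ((decΩ cellOf E Dω w.1 w.2.1 w.2.2).card : ℝ)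
        ≤ κ₁ * (P * (1 + (pathLen d w.1 y + crSum cr w.1 w.2.2) / r)) := this
      _ = κ₁ * P + κ₁ * (P / r) * (pathLen d w.1 y + crSum cr w.1 w.2.2) := by ring

/-! ## §3 Non-vacuity -/

section Witness

open Summit.QuantumFields.BalabanUV.Beta.UnitLatticeOmegaWitness (d0 h1 E1 K0 near0 L1 Dω0 weightHyp_zero)

/-- **NON-VACUITY**: `dominates_walkTermΩ_cells` APPLIED to the one-site data of `UnitLatticeOmegaWitness` (zero pieces, empty
domains and cell budgets, `κ = 0`, `κ₁ = 1`, `r = R = 1`, `D = 0`, `P = 1`), every binder discharged. [folklore] -/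
theorem dominates_cells_witness :
    Dominates (1 : ℝ) (fun w : WalkΩ (Fin 1) (Fin 1) => decΩ (fun y : Fin 1 => y) E1 Dω0 w.1 w.2.1 w.2.2)
      (fun w => walkTermΩ h1 K0 near0 L1 w.1 w.2.1 w.2.2)
      (decMajΩ (Real.exp (1 * (1 : ℕ))) (1 * ((1 : ℕ) / 1)) d0 (crCells 1 1 cells0) h1 K0 near0 L1) := by
  refine dominates_walkTermΩ_cells (κ := 0) (weightHyp_zero le_rfl) K0 Dω0 (fun ω k l hk => ?_) near0 h1 E1 L1
    (fun b y hy => absurd (Finset.mem_univ y) hy) (κ₁ := 1) (r := 1) (D := 0) (R := 1) zero_le_one one_pos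
    (by norm_num) (fun y : Fin 1 => y) (P := 1) (fun a => ?_) (fun b z _ z' _ => le_of_eq rfl) cells0
    (fun ω z hz => absurd hz (Finset.notMem_empty z)) (crCells 1 1 cells0) (fun ω => crCells_spec one_pos cells0 ω)
  · simp [K0] at hk
  · exact ⟨Finset.univ, by simp, fun z _ => Finset.mem_univ _⟩

end Witness

end

end Summit.QuantumFields.BalabanUV.Beta.UnitLatticeOmegaDominates
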